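import Mathlib
import HarnessLib
import Literature.Analysis.FluidPDE.TsaiLocalPressureSup
import Literature.Analysis.FluidPDE.LerayHopfConcatenation
import Summits.NavierStokesRegularity.NavierStokesRegularity.Theorems.LocalSineTubeDoorLocalPointZoomUniform
import Summits.NavierStokesRegularity.NavierStokesRegularity.Theorems.LocalSineTubeDoorLocalPointZoomGrad
import Summits.NavierStokesRegularity.NavierStokesRegularity.Theorems.LocalVelCompTubeDoorLocalPointZoomVel
import Summits.NavierStokesRegularity.NavierStokesRegularity.Theorems.PlaneStrainDoorZoomSpaceTimeDecay
import Summits.NavierStokesRegularity.NavierStokesRegularity.Theorems.LocalPressureProfileDoorPressureCovariance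
import Summits.NavierStokesRegularity.NavierStokesRegularity.Theorems.LocalPressureProfileDoorPressureSliceLimit

/-!
# Route `LocalPressureProfileDoor` (door S17⁺), crux K1 `LocalPointZoomSimilarityPressure`
# (stmt-NavierStokesRegularity-20181) — helper 3: the Riesz pressure potential converges at the slice `s = −1`
# of the local zoom frame

Seat `ns-pressure-K1-p1` (`--supports stmt-NavierStokesRegularity-20181`).  In the tree's local zoom frame
(`localTreeZoomFrame`: half-zoom `v'` of class `Q(0,1)` with pressure `π'`, scales `λⱼ → 0⁺`, zooms
`Zⱼ = λⱼ • (v' ∘ λⱼ) = (s,y) ↦ (Λⱼ/ν) u(T + Λⱼ² s/ν, x₀ + Λⱼ y)`, `Λⱼ = Rλⱼ/2`, profile `v₁`) at a point that is locally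
SPACE–TIME Type I, the Riesz pressures of the slices converge at every point:
`Q[Zⱼ(−1)](y) → Q[v₁(−1)](y)` (`localZoomFrame_pressure_tendsto`).  Proof = the slice lemma
(`…PressureSliceLimit`) at cutoff scale `R = 1/4` with:

* NEAR: the 2-jets of `Zⱼ(−1)` converge at every point (`localZoomFrame_tendsto`, `localZoomFrame_fderiv_tendsto`,
  (H) of `localZoomFrame_uniform`), hence so do the sources `G[Zⱼ(−1)]` (`tendsto_pressureSource_of_tendsto_jet`);
  they are uniformly bounded on `B(y, 7/8)` by Seregin–Šverák's quantitative interior regularity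
  (`NSBoundedHigherRegularityBounds_holds` on the data of `localZoomFrame_data`);
* FAR: the space–time bound gives `‖Zⱼ(−1)(η)‖ ≤ (M/ν)/(1+‖η‖)` on `‖η‖ < ρ/Λⱼ`, and the Leray–Hopf energy bound gives
  `∫‖Zⱼ(−1)‖² ≤ 2E₀ Λⱼ⁻¹ν⁻²`, so the tail is `O(Λⱼ²)`.

WHAT THIS IS NOT: not a claim about Navier–Stokes regularity; a compactness lemma for a CONDITIONAL door's K1.
-/

noncomputable section

-- the summit and its single sub-problem share the name (CONVENTIONS §1), as in every Theorems file
set_option linter.dupNamespace false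
-- nested operator types `ℝ³ →L[ℝ] ℝ³ →L[ℝ] ℝ³ →L[ℝ] ℝ`
set_option maxSynthPendingDepth 3

namespace Summit.NavierStokesRegularity.NavierStokesRegularity.Theorems.LocalPressureProfileDoorZoomFramePressure

open MeasureTheory Set Function Filter Topology TopologicalSpace Metric
open Literature.Analysis Literature.Analysis.FluidPDE Literature.Analysis.FluidPDE.SereginSverak2009
open Summit.NavierStokesRegularity.NavierStokesRegularity.Theorems
open Summit.NavierStokesRegularity.NavierStokesRegularity.Theorems.LocalSineTubeDoorProfileAlignedWindowRigidityAncient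
open Summit.NavierStokesRegularity.NavierStokesRegularity.Theorems.LocalSineTubeDoorLocalPointZoomData
open Summit.NavierStokesRegularity.NavierStokesRegularity.Theorems.LocalVelCompTubeDoorLocalPointZoomVel
open Summit.NavierStokesRegularity.NavierStokesRegularity.Theorems.LocalSineTubeDoorLocalPointZoomGrad
open Summit.NavierStokesRegularity.NavierStokesRegularity.Theorems.LocalSineTubeDoorLocalPointZoomUniform
open Summit.NavierStokesRegularity.NavierStokesRegularity.Theorems.PlaneStrainDoorZoomSpaceTimeDecay
open Summit.NavierStokesRegularity.NavierStokesRegularity.Theorems.LocalPressureProfileDoorPressureCovariance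
open Summit.NavierStokesRegularity.NavierStokesRegularity.Theorems.LocalPressureProfileDoorPressureSliceLimit
open scoped NNReal ENNReal

set_option maxHeartbeats 400000 in
/-- **The Riesz pressure potential converges at the slice `s = −1` of the local zoom frame** (module docstring): at a
locally SPACE–TIME Type-I point of a classical Leray–Hopf flow, in the tree's local zoom frame,
`pressurePotential (Zⱼ(−1)) y → pressurePotential (v₁(−1)) y` for every `y`, provided the profile slice `v₁(−1)` lies in
the decay class `Cd/(1+|η|)` (which the space–time decay of the profile supplies). -/
theorem localZoomFrame_pressure_tendsto {ν T : ℝ} (hν : 0 < ν) (hT : 0 < T)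
    {u : ℝ → (EuclideanSpace ℝ (Fin 3)) → (EuclideanSpace ℝ (Fin 3))} {p : ℝ → (EuclideanSpace ℝ (Fin 3)) → ℝ}
    (hsol : IsClassicalNSSolutionOn (Ico 0 T) ν 0 u p) (hLH : IsLerayHopfOn T ν 0 (u 0) u)
    {x₀ : (EuclideanSpace ℝ (Fin 3))} {ρ M : ℝ} (hρ : 0 < ρ)
    (hMst : ∀ t ∈ Ico 0 T, T - ρ ^ 2 < t → ∀ x ∈ ball x₀ ρ, ‖u t x‖ * (‖x - x₀‖ + Real.sqrt (ν * (T - t))) ≤ M)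
    {R : ℝ} (hR : 0 < R) {v' : ℝ → (EuclideanSpace ℝ (Fin 3)) → (EuclideanSpace ℝ (Fin 3))}
    {π' : ℝ → (EuclideanSpace ℝ (Fin 3)) → ℝ}
    (hball1 : IsSuitableWeakSolutionInBall 1 0 v' π') {lam : ℕ → ℝ} (hlam : ∀ j, 0 < lam j)
    (hlam0 : Tendsto lam atTop (𝓝 0)) {Ks : ℝ≥0} {r₁ : ℝ} (hr₁ : 0 < r₁) (hr₁1 : r₁ ≤ 1)
    (hKs : ∀ r ∈ Ioc (0 : ℝ) r₁, cknD r (0 : ℝ × (EuclideanSpace ℝ (Fin 3))) π' ≤ Ks)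
    (hpt : ∀ (j : ℕ) (s : ℝ) (y : (EuclideanSpace ℝ (Fin 3))),
      ((lam j) • stPull ((lam j) ^ 2) (lam j) (0 : ℝ) (0 : (EuclideanSpace ℝ (Fin 3))) v') s y =
      ((R * (lam j / 2)) / ν) • u (T + (R * (lam j / 2)) ^ 2 * s / ν) (x₀ + (R * (lam j / 2)) • y))
    {w v₁ : ℝ → (EuclideanSpace ℝ (Fin 3)) → (EuclideanSpace ℝ (Fin 3))}
    (hL3 : ∀ a : ℝ, 0 < a → Tendsto (fun j => eLpNorm (uncurry ((lam j) • stPull ((lam j) ^ 2) (lam j) (0 : ℝ)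
      (0 : (EuclideanSpace ℝ (Fin 3))) v') - uncurry w) 3
      (volume.restrict (parabolicCylinder a (0 : ℝ × (EuclideanSpace ℝ (Fin 3)))))) atTop (𝓝 0))
    (hae : ∀ᵐ x ∂(volume.restrict (Iio (0 : ℝ) ×ˢ (univ : Set (EuclideanSpace ℝ (Fin 3))))),
      uncurry w x = uncurry v₁ x)
    {C₁ : ℝ} (hv₁rate : HasTypeITimeDecay C₁ v₁) (hv₁cont : ContinuousOn (uncurry v₁) (Iio (0 : ℝ) ×ˢ univ))
    (hv₁mild : ∀ s t : ℝ, s < t → t < 0 → ∀ x,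
      v₁ t x = UnboundedOperators.heatExtension (v₁ s) (t - s) x - oseenDuhamel 1 s v₁ v₁ t x)
    {Cd : ℝ} (hv₁dec : ∀ η : EuclideanSpace ℝ (Fin 3), ‖v₁ (-1) η‖ ≤ Cd / (1 + ‖η‖))
    (y : (EuclideanSpace ℝ (Fin 3))) :
    Tendsto (fun j => pressurePotential (((lam j) • stPull ((lam j) ^ 2) (lam j) (0 : ℝ)
      (0 : (EuclideanSpace ℝ (Fin 3))) v') (-1)) y) atTop (𝓝 (pressurePotential (v₁ (-1)) y)) := by
  have hM := timeTypeI_of_spaceTimeTypeI hMst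
  have hcont : ContinuousOn (uncurry u) (Ico 0 T ×ˢ univ) := hsol.smooth_velocity.continuousOn
  -- ## the physical scales `Λⱼ = Rλⱼ/2 → 0⁺` and the zoom times `tⱼ = T − Λⱼ²/ν` at the slice `s = −1`
  set Λ : ℕ → ℝ := fun j => R * (lam j / 2) with hΛdef
  have hΛpos : ∀ j, 0 < Λ j := fun j => mul_pos hR (half_pos (hlam j))
  have hΛ0 : Tendsto Λ atTop (𝓝 0) := by
    show Tendsto (fun j => R * (lam j / 2)) atTop (𝓝 0)
    simpa using (hlam0.div_const 2).const_mul R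
  set Z : ℕ → ℝ → (EuclideanSpace ℝ (Fin 3)) → (EuclideanSpace ℝ (Fin 3)) :=
    fun j => (lam j) • stPull ((lam j) ^ 2) (lam j) (0 : ℝ) (0 : (EuclideanSpace ℝ (Fin 3))) v' with hZdef
  have hZpt : ∀ (j : ℕ) (s : ℝ) (y' : (EuclideanSpace ℝ (Fin 3))),
      Z j s y' = (Λ j / ν) • u (T + Λ j ^ 2 * s / ν) (x₀ + Λ j • y') := hpt
  set tj : ℕ → ℝ := fun j => T + Λ j ^ 2 * (-1) / ν with htjdef
  have hνT : ∀ j, ν * (T - tj j) = Λ j ^ 2 := fun j => by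
    simp only [htjdef]; field_simp; ring
  have htj_lt : ∀ j, tj j < T := fun j => by
    have : 0 < Λ j ^ 2 / ν := div_pos (pow_pos (hΛpos j) 2) hν
    have e : tj j = T - Λ j ^ 2 / ν := by simp only [htjdef]; ring
    rw [e]; linarith
  have htjT : Tendsto tj atTop (𝓝 T) := by
    have h : Tendsto (fun j => T + Λ j ^ 2 * (-1) / ν) atTop (𝓝 (T + 0 ^ 2 * (-1) / ν)) :=
      tendsto_const_nhds.add (((hΛ0.pow 2).mul_const (-1)).div_const ν)
    have e : T + (0 : ℝ) ^ 2 * (-1) / ν = T := by ring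
    rw [e] at h
    exact h
  have hev_t : ∀ᶠ j in atTop, tj j ∈ Ico 0 T ∧ T - ρ ^ 2 < tj j := by
    filter_upwards [htjT.eventually (lt_mem_nhds hT),
      htjT.eventually (lt_mem_nhds (by nlinarith [pow_pos hρ 2] : T - ρ ^ 2 < T))] with j h1 h2
    exact ⟨⟨h1.le, htj_lt j⟩, h2⟩
  have hZfun : ∀ j, Z j (-1) = fun η => (Λ j / ν) • u (tj j) (x₀ + Λ j • η) := fun j => funext (hZpt j (-1))
  -- ## regularity of the slices
  have hZC2 : ∀ᶠ j in atTop, ContDiff ℝ 2 (Z j (-1)) := by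
    filter_upwards [hev_t] with j hj
    rw [hZfun j]
    exact (((hsol.contDiff_velocity hj.1).of_le (by norm_cast)).comp
      (contDiff_const.add (contDiff_id.const_smul _))).const_smul _
  have hv₁an : AnalyticOnNhd ℝ (v₁ (-1)) univ :=
    analyticOnNhd_slice hv₁cont (bdd_of_hasTypeITimeDecay hv₁rate) hv₁mild (by norm_num : (-1 : ℝ) < 0)
  have hv₁C2 : ContDiff ℝ 2 (v₁ (-1)) := hv₁an.contDiff
  -- ## the 2-jets converge at every point, hence so do the sources
  have h0 : ∀ y' : EuclideanSpace ℝ (Fin 3), Tendsto (fun j => Z j (-1) y') atTop (𝓝 (v₁ (-1) y')) := fun y' =>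
    localZoomFrame_tendsto hν hT hcont hρ hM hR hball1 hlam hlam0 hr₁ hr₁1 hKs hpt hL3 hae hv₁cont y'
  have h1 : ∀ y' : EuclideanSpace ℝ (Fin 3), Tendsto (fun j => fderiv ℝ (Z j (-1)) y') atTop
      (𝓝 (fderiv ℝ (v₁ (-1)) y')) := fun y' =>
    localZoomFrame_fderiv_tendsto hν hT hcont hρ hM hR hball1 hlam hlam0 hr₁ hr₁1 hKs hpt hL3 hae hv₁rate
      hv₁cont hv₁mild y'
  have h2 : ∀ y' : EuclideanSpace ℝ (Fin 3), Tendsto (fun j => fderiv ℝ (fderiv ℝ (Z j (-1))) y') atTop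
      (𝓝 (fderiv ℝ (fderiv ℝ (v₁ (-1))) y')) := fun y' =>
    tendsto_fderiv_fderiv_of_tendsto_iteratedFDeriv_two hZC2 hv₁C2
      (localZoomFrame_uniform hν hT hcont hρ hM hR hball1 hlam hlam0 hr₁ hr₁1 hKs hpt hL3 hae hv₁rate hv₁cont
        hv₁mild y').2.2
  have hsrc : ∀ y' : EuclideanSpace ℝ (Fin 3), Tendsto (fun j => pressureSource (Z j (-1)) y') atTop
      (𝓝 (pressureSource (v₁ (-1)) y')) := fun y' =>
    tendsto_pressureSource_of_tendsto_jet hZC2 hv₁C2 y' (h0 y') (h1 y') (h2 y')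
  -- ## uniform 2-jet bounds on `B(y, 7/8)` (Seregin–Šverák on the data of `localZoomFrame_data`)
  obtain ⟨J, hJ⟩ := localZoomFrame_data hν hT hρ hM hR hball1 hlam hlam0 hr₁ hr₁1 hKs hpt y
  obtain ⟨K₀, hK₀⟩ := NSBoundedHigherRegularityBounds_holds.exists_uniform_bound (1 : ℝ) (M * Real.sqrt 2 / ν)
    (((‖y‖ + 2) ^ 2).toNNReal * Ks) (r := 7 / 8) ⟨by norm_num, by norm_num⟩ 2
  have hmemQ : ∀ {r : ℝ} {w : ℝ × (EuclideanSpace ℝ (Fin 3))},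
      w ∈ parabolicCylinder r ((-(1 / 2) : ℝ), y) ↔
        (-(1 / 2) - r ^ 2 < w.1 ∧ w.1 < -(1 / 2)) ∧ dist w.2 y < r := by
    intro r w
    simp only [parabolicCylinder, mem_prod, mem_Ioo, mem_ball]
  have hQ71 : parabolicCylinder (7 / 8) ((-(1 / 2) : ℝ), y) ⊆ parabolicCylinder 1 ((-(1 / 2) : ℝ), y) := by
    intro w hw
    rw [hmemQ] at hw ⊢
    obtain ⟨⟨h1, h2⟩, h3⟩ := hw
    exact ⟨⟨by linarith, h2⟩, by linarith⟩
  have hmem7 : ∀ y' ∈ ball y (7 / 8), ((-1 : ℝ), y') ∈ parabolicCylinder (7 / 8) ((-(1 / 2) : ℝ), y) := by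
    intro y' hy'
    rw [hmemQ]
    exact ⟨⟨by norm_num, by norm_num⟩, mem_ball.1 hy'⟩
  have htime : ∀ j, J ≤ j → ∀ s : ℝ, -(3 / 2) < s → s < -(1 / 2) → T + Λ j ^ 2 * s / ν ∈ Ico 0 T := by
    intro j hj s hs1 hs2
    have hC : Λ j ^ 2 * 2 < ν * T := (hJ j hj).1
    have hΛ2 : 0 < Λ j ^ 2 := pow_pos (hΛpos j) 2
    refine ⟨?_, ?_⟩
    · have key : 0 ≤ ν * T + Λ j ^ 2 * s := by nlinarith
      have e : T + Λ j ^ 2 * s / ν = (ν * T + Λ j ^ 2 * s) / ν := by field_simp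
      rw [e]
      exact div_nonneg key hν.le
    · have : Λ j ^ 2 * s / ν < 0 := div_neg_of_neg_of_pos (by nlinarith) hν
      linarith
  have hZcont : ∀ j, J ≤ j → ContinuousOn (uncurry (Z j)) (parabolicCylinder 1 ((-(1 / 2) : ℝ), y)) := by
    intro j hj
    have hφ : Continuous fun w : ℝ × (EuclideanSpace ℝ (Fin 3)) => (T + Λ j ^ 2 * w.1 / ν, x₀ + Λ j • w.2) := by
      fun_prop
    have hmaps : MapsTo (fun w : ℝ × (EuclideanSpace ℝ (Fin 3)) => (T + Λ j ^ 2 * w.1 / ν, x₀ + Λ j • w.2))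
        (parabolicCylinder 1 ((-(1 / 2) : ℝ), y)) (Ico 0 T ×ˢ univ) := by
      intro w hw
      rw [hmemQ] at hw
      exact mem_prod.2 ⟨htime j hj w.1 (by linarith [hw.1.1]) hw.1.2, mem_univ _⟩
    have hc := (hcont.comp hφ.continuousOn hmaps).const_smul (Λ j / ν)
    refine hc.congr fun w _ => ?_
    exact hZpt j w.1 w.2
  have hjet : ∀ j, J ≤ j → ∀ y' ∈ ball y (7 / 8),
      ‖Z j (-1) y'‖ ≤ K₀ ∧ ‖fderiv ℝ (Z j (-1)) y'‖ ≤ K₀ ∧ ‖iteratedFDeriv ℝ 2 (Z j (-1)) y'‖ ≤ K₀ := by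
    intro j hj y' hy'
    obtain ⟨V, hVae, hVcont, -, -, hVbd⟩ := hK₀ (Z j)
      ((lam j) ^ 2 • stPull ((lam j) ^ 2) (lam j) (0 : ℝ) (0 : (EuclideanSpace ℝ (Fin 3))) π')
      ((-(1 / 2) : ℝ), y) (hJ j hj).2.1 (hJ j hj).2.2.1 (hJ j hj).2.2.2
    have hEqOn : EqOn (uncurry (Z j)) (uncurry V) (parabolicCylinder (7 / 8) ((-(1 / 2) : ℝ), y)) :=
      Measure.eqOn_open_of_ae_eq (ae_restrict_of_ae_restrict_of_subset hQ71 hVae)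
        (isOpen_parabolicCylinder _ _) ((hZcont j hj).mono hQ71) (hVcont.mono hQ71)
    have hev : Z j (-1) =ᶠ[𝓝 y'] V (-1) := by
      filter_upwards [isOpen_ball.mem_nhds hy'] with y'' hy''
      exact hEqOn (hmem7 y'' hy'')
    have hw : ((-1 : ℝ), y') ∈ parabolicCylinder (7 / 8) ((-(1 / 2) : ℝ), y) := hmem7 y' hy'
    have hb0 : ‖iteratedFDeriv ℝ 0 (V (-1)) y'‖ ≤ K₀ := hVbd 0 (Nat.zero_le 2) ((-1 : ℝ), y') hw
    have hb1 : ‖iteratedFDeriv ℝ 1 (V (-1)) y'‖ ≤ K₀ := hVbd 1 one_le_two ((-1 : ℝ), y') hw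
    have hb2 : ‖iteratedFDeriv ℝ 2 (V (-1)) y'‖ ≤ K₀ := hVbd 2 le_rfl ((-1 : ℝ), y') hw
    rw [norm_iteratedFDeriv_zero] at hb0
    rw [norm_iteratedFDeriv_one] at hb1
    refine ⟨?_, ?_, ?_⟩
    · rw [hev.eq_of_nhds]; exact hb0
    · rw [hev.fderiv_eq]; exact hb1
    · rw [(hev.iteratedFDeriv ℝ 2).eq_of_nhds]; exact hb2
  -- the uniform source bound on `B(y, 7/8)`
  set Tr : ℝ := ‖(traceCLM : ((EuclideanSpace ℝ (Fin 3)) →L[ℝ] (EuclideanSpace ℝ (Fin 3))) →L[ℝ] ℝ)‖ with hTr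
  set B : ℝ := 2 * Tr * K₀ * K₀ + (Tr + Tr ^ 2) * K₀ ^ 2 with hBdef
  have hB : ∀ᶠ j in atTop, ∀ z : EuclideanSpace ℝ (Fin 3), ‖z‖ < 1 / 4 * 2 →
      |pressureSource (Z j (-1)) (y - z)| ≤ B := by
    filter_upwards [hZC2, eventually_ge_atTop J] with j hj2 hjJ z hz
    have hy' : y - z ∈ ball y (7 / 8) := by
      rw [mem_ball, dist_eq_norm, sub_sub_cancel_left, norm_neg]; linarith
    obtain ⟨b0, b1, b2⟩ := hjet j hjJ (y - z) hy'
    have hK₀0 : 0 ≤ K₀ := (norm_nonneg _).trans b0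
    have b2' : ‖fderiv ℝ (fderiv ℝ (Z j (-1))) (y - z)‖ ≤ K₀ := by
      have e : ‖fderiv ℝ (fderiv ℝ (Z j (-1))) (y - z)‖ = ‖iteratedFDeriv ℝ 2 (Z j (-1)) (y - z)‖ := by
        rw [← norm_iteratedFDeriv_fderiv, ← norm_iteratedFDeriv_fderiv, norm_iteratedFDeriv_zero]
      rw [e]; exact b2
    refine (abs_pressureSource_le hj2 (y - z)).trans ?_
    rw [hBdef]
    have hTr0 : 0 ≤ Tr := norm_nonneg _
    gcongr
  -- ## NEAR part at cutoff scale `1/4`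
  have hnear : Tendsto (fun j => nearPotential (1 / 4 * 1) (1 / 4 * 2) (Z j (-1)) y) atTop
      (𝓝 (nearPotential (1 / 4 * 1) (1 / 4 * 2) (v₁ (-1)) y)) :=
    tendsto_nearPotential_of_source (by norm_num) (by norm_num) y hZC2 (fun z _ => hsrc (y - z)) hB
  -- ## FAR part: local decay from the space–time bound, tail from the energy
  have hΛ0' : Tendsto Λ atTop (𝓝[>] 0) :=
    tendsto_nhdsWithin_iff.2 ⟨hΛ0, Eventually.of_forall hΛpos⟩
  have hρseq : Tendsto (fun j => ρ / Λ j) atTop atTop := by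
    have h := (tendsto_inv_nhdsGT_zero.comp hΛ0').const_mul_atTop hρ
    refine h.congr fun j => ?_
    simp only [Function.comp_apply, div_eq_mul_inv]
  have hdecay : ∀ᶠ j in atTop, ∀ η : EuclideanSpace ℝ (Fin 3), ‖η‖ < ρ / Λ j →
      ‖Z j (-1) η‖ ≤ (M / ν) / (1 + ‖η‖) := by
    filter_upwards [hev_t] with j hj η hη
    have hΛj := hΛpos j
    have hx : x₀ + Λ j • η ∈ ball x₀ ρ := by
      rw [mem_ball, dist_eq_norm, add_sub_cancel_left, norm_smul, Real.norm_of_nonneg hΛj.le]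
      rwa [lt_div_iff₀ hΛj, mul_comm] at hη
    have hb := hMst (tj j) hj.1 hj.2 (x₀ + Λ j • η) hx
    rw [add_sub_cancel_left, norm_smul, Real.norm_of_nonneg hΛj.le, hνT j, Real.sqrt_sq hΛj.le] at hb
    rw [hZpt j (-1) η, norm_smul, Real.norm_of_nonneg (div_pos hΛj hν).le,
      le_div_iff₀ (by positivity : (0 : ℝ) < 1 + ‖η‖), div_mul_eq_mul_div, div_mul_eq_mul_div,
      div_le_div_iff_of_pos_right hν]
    calc Λ j * ‖u (T + Λ j ^ 2 * (-1) / ν) (x₀ + Λ j • η)‖ * (1 + ‖η‖)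
        = ‖u (tj j) (x₀ + Λ j • η)‖ * (Λ j * ‖η‖ + Λ j) := by simp only [htjdef]; ring
      _ ≤ M := hb
  -- energies
  set E₀ : ℝ := VectorCalculus.kineticEnergy (u 0) with hE₀
  set E : ℕ → ℝ := fun j => (Λ j / ν) ^ 2 * ((Λ j ^ 3)⁻¹ * (2 * E₀)) with hEdef
  have hL2 : ∀ᶠ j in atTop, Integrable (fun η => ‖Z j (-1) η‖ ^ 2) ∧ ∫ η, ‖Z j (-1) η‖ ^ 2 ≤ E j := by
    filter_upwards [hev_t] with j hj
    have hΛj := hΛpos j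
    have htI : tj j ∈ Icc 0 T := ⟨hj.1.1, hj.1.2.le⟩
    have hbase : Integrable (fun x => ‖u (tj j) x‖ ^ 2) := (hLH.memLp (tj j) htI).integrable_norm_pow two_ne_zero
    have hg : Integrable (fun x : EuclideanSpace ℝ (Fin 3) => ‖u (tj j) (x₀ + x)‖ ^ 2) := hbase.comp_add_left x₀
    have hgs : Integrable (fun η : EuclideanSpace ℝ (Fin 3) => ‖u (tj j) (x₀ + Λ j • η)‖ ^ 2) :=
      hg.comp_smul hΛj.ne'
    have hfun : (fun η => ‖Z j (-1) η‖ ^ 2) = fun η => (Λ j / ν) ^ 2 * ‖u (tj j) (x₀ + Λ j • η)‖ ^ 2 := by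
      funext η
      rw [hZpt j (-1) η, norm_smul, Real.norm_of_nonneg (div_pos hΛj hν).le, mul_pow]
    rw [hfun]
    refine ⟨hgs.const_mul _, ?_⟩
    rw [integral_const_mul]
    have hsub : ∫ η : EuclideanSpace ℝ (Fin 3), ‖u (tj j) (x₀ + Λ j • η)‖ ^ 2 =
        (Λ j ^ 3)⁻¹ * ∫ x, ‖u (tj j) x‖ ^ 2 := by
      have h := Measure.integral_comp_smul_of_nonneg (μ := volume)
        (fun x : EuclideanSpace ℝ (Fin 3) => ‖u (tj j) (x₀ + x)‖ ^ 2) (Λ j) (hR := hΛj.le)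
      rw [finrank_euclideanSpace_fin, smul_eq_mul] at h
      rw [h, integral_add_left_eq_self (fun x => ‖u (tj j) x‖ ^ 2) x₀]
    have hen : ∫ x, ‖u (tj j) x‖ ^ 2 ≤ 2 * E₀ := by
      have hk := hLH.kineticEnergy_le_of_zero_force hν.le htI
      have e : ∫ x, ‖u (tj j) x‖ ^ 2 = 2 * VectorCalculus.kineticEnergy (u (tj j)) := by
        rw [VectorCalculus.kineticEnergy]; ring
      rw [e]; linarith
    rw [hsub]
    show (Λ j / ν) ^ 2 * ((Λ j ^ 3)⁻¹ * ∫ x, ‖u (tj j) x‖ ^ 2) ≤ (Λ j / ν) ^ 2 * ((Λ j ^ 3)⁻¹ * (2 * E₀))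
    have h3 : 0 ≤ (Λ j ^ 3)⁻¹ := inv_nonneg.2 (pow_nonneg hΛj.le 3)
    gcongr
  have hE : Tendsto (fun j => E j / (ρ / Λ j) ^ 3) atTop (𝓝 0) := by
    have e : ∀ j, E j / (ρ / Λ j) ^ 3 = (2 * E₀ / (ν ^ 2 * ρ ^ 3)) * Λ j ^ 2 := by
      intro j
      have hΛj := (hΛpos j).ne'
      simp only [hEdef]
      field_simp
    simp_rw [e]
    simpa using (hΛ0.pow 2).const_mul (2 * E₀ / (ν ^ 2 * ρ ^ 3))
  have hfar : Tendsto (fun j => farPotential (1 / 4 * 1) (1 / 4 * 2) (Z j (-1)) y) atTop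
      (𝓝 (farPotential (1 / 4 * 1) (1 / 4 * 2) (v₁ (-1)) y)) :=
    tendsto_farPotential_of_localDecay (by norm_num) (by norm_num) y (hZC2.mono fun j hj => hj.continuous) h0
      hρseq hdecay hL2 hE
  -- ## assemble
  exact tendsto_pressurePotential_of_near_far (by norm_num : (0 : ℝ) < 1 / 4) y hZC2
    (hL2.mono fun j hj => hj.1) hv₁C2 hv₁dec hnear hfar

end Summit.NavierStokesRegularity.NavierStokesRegularity.Theorems.LocalPressureProfileDoorZoomFramePressure

end
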